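import Summits.NavierStokesRegularity.NavierStokesRegularity.Theorems.QuarterLogPincerTypeIQuantSubcubicExpFlatWindowExplicitWindow
import HarnessLib

/-!
# The `flat_window` rung AS TYPED is Chae–Wolf 2017 Thm 1.3 — refuter side, negative lane

Crux `stmt-NavierStokesRegularity-24077` (`QuarterLogPincer.TypeIQuantSubcubicExp`, wall W7), rung line
`Cruxes/TypeIQuantSubcubicExp/Lines/flat_window.lean`, landed rung `FlatWindow.removingDss_explicitWindow`
(p633176):

  `∀ C₀ > 0, ∃ δ₀ B, 0 < δ₀ ∧ 0 < B ∧ OneSliceThreshold C₀ δ₀ ∧ AccelerationBound C₀ B ∧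
     ∀ c, 1 < c → c ≤ exp(δ₀/(2B)) → (classical ancient ∧ c-DSS ∧ HasTypeIDecay C₀ ⇒ u ≡ 0)`.

Companion of `Negative/AnalyticWindowRungTyped.lean` (p644572, the ranges-only `analytic_window` rung).
Here the `∃`-bound constants ARE tied to their defining predicates, but both predicates are MONOTONE —
a one-slice threshold may be shrunk (`oneSliceThreshold_mono`), an acceleration bound may be enlarged
(`accelerationBound_mono`) — and the displayed window `exp(δ₀/(2B))` tends to `1` under exactly these
moves.  Hence (kernel-checked below, real arithmetic only):

* `explicitWindowRung_iff_chaeWolf` : the rung statement AS TYPED ⟺ `chaeWolf2017_removing_dss`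
  (Chae–Wolf 2017 Thm 1.3), given the two landed inhabitation theorems `oneSliceThreshold_exists`
  (Pineau–Vicol Thm 1.9) and `stub_accelerationBound`; in the direction rung ⇒ CW nothing is used;
* `explicitWindowRung_thin` : for every `C₀ > 0` and every `ℓ > 0` the rung's witnesses can be chosen
  with window `exp(δ₀/(2B)) < exp ℓ` — the typed display pins NO exclusion ratio `λ₀(C₀)`.

READING (for the W7 board / DSS census / ARM B «largest certified λ₀»): no near-one rung in the tree
whose window is a formula in `∃`-bound constants is typed-stronger than Chae–Wolf 1.3; the quantitative
content of the `flat_window` line is the PARAMETRIC theorem `removingDss_window_of` (window in terms of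
GIVEN data `δ₀, B, Cp`), exactly as the `analytic_window` line's content is its parametric
`analyticWindow_rung` (v3).  A certified number `λ₀ > 1` therefore requires pinned constants (instrument
readout v2: 0/5 are numeric in tree or print) — it cannot be read off any `∃`-rung.  The lead's own
framing of p633176 («window a FORMULA in two effective-in-principle constants, not computed») is
consistent with this; the file records the typed fact for the census.

Nothing here asserts S3, the crux 24077, or any Theses statement; no summit statement is proved by this
file; Navier–Stokes regularity is OPEN.
-/

-- the summit and its single sub-problem share the name (CONVENTIONS §1), as in every Theorems file
set_option linter.dupNamespace false

namespace Summit.NavierStokesRegularity.NavierStokesRegularity.Theorems.TypeIQuantSubcubicExp.Negative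

open Set
open Literature.Analysis Literature.Analysis.FluidPDE
open Summit.NavierStokesRegularity.NavierStokesRegularity.Cruxes.TypeIQuantSubcubicExp.FlatWindow

/-! ### 1. Monotonicity of the two predicates -/

/-- A one-slice threshold may be shrunk. [folklore] -/
theorem oneSliceThreshold_mono {Cu δ₀ δ₁ : ℝ} (h : OneSliceThreshold Cu δ₀) (hδ₁ : 0 < δ₁)
    (hle : δ₁ ≤ δ₀) : OneSliceThreshold Cu δ₁ := by
  refine ⟨hδ₁, fun Cp hCp => ?_⟩
  obtain ⟨s₀, hs₀, H⟩ := h.2 Cp hCp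
  exact ⟨s₀, hs₀, fun u p hreg henv hpr tbar h1 h2 hflat =>
    H u p hreg henv hpr tbar h1 h2 fun x hx => (hflat x hx).trans hle⟩

/-- An acceleration bound may be enlarged. [folklore] -/
theorem accelerationBound_mono {C₀ B B' : ℝ} (h : AccelerationBound C₀ B) (hle : B ≤ B') :
    AccelerationBound C₀ B' := fun u p hsol hdec y =>
  ⟨(h u p hsol hdec y).1, fun s => ((h u p hsol hdec y).2 s).trans hle⟩

/-- Enlarging `B` to `max B (δ₀/ℓ)` pushes the window exponent below `ℓ/2`. [folklore] -/
theorem window_exponent_le {δ₀ B ℓ : ℝ} (hδ₀ : 0 < δ₀) (hB : 0 < B) (hℓ : 0 < ℓ) :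
    δ₀ / (2 * max B (δ₀ / ℓ)) ≤ ℓ / 2 := by
  have hM : δ₀ / ℓ ≤ max B (δ₀ / ℓ) := le_max_right _ _
  have hMpos : 0 < max B (δ₀ / ℓ) := lt_max_of_lt_left hB
  calc δ₀ / (2 * max B (δ₀ / ℓ)) ≤ δ₀ / (2 * (δ₀ / ℓ)) :=
        div_le_div_of_nonneg_left hδ₀.le (by positivity) (by linarith)
    _ = ℓ / 2 := by field_simp

/-! ### 2. The rung as typed ⟺ Chae–Wolf 2017 Thm 1.3 -/

-- The rung statement below is, token for token, the type of `FlatWindow.removingDss_explicitWindow`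
-- (p633176; not restated as a theorem here — gate dedup); the equivalence is visibly about THAT statement.

/-- **The `flat_window` rung as typed ⇒ Chae–Wolf 1.3** (take `c₁` = the displayed window; the predicates
`OneSliceThreshold`, `AccelerationBound` are not used). [folklore] -/
theorem chaeWolf_of_explicitWindowRung
    (h : ∀ C₀ : ℝ, 0 < C₀ → ∃ δ₀ B : ℝ, 0 < δ₀ ∧ 0 < B ∧ OneSliceThreshold C₀ δ₀ ∧ AccelerationBound C₀ B ∧
      ∀ c : ℝ, 1 < c → c ≤ Real.exp (δ₀ / (2 * B)) →
        ∀ (u : ℝ → EuclideanSpace ℝ (Fin 3) → EuclideanSpace ℝ (Fin 3)) (p : ℝ → EuclideanSpace ℝ (Fin 3) → ℝ),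
          IsClassicalNSSolutionOn (Iio 0) 1 0 u p → IsDiscretelySelfSimilar c u → HasTypeIDecay C₀ u →
          ∀ t < 0, ∀ x, u t x = 0) :
    chaeWolf2017_removing_dss := by
  intro C₀ hC₀
  obtain ⟨δ₀, B, hδ₀, hB, -, -, hW⟩ := h C₀ hC₀
  refine ⟨Real.exp (δ₀ / (2 * B)), Real.one_lt_exp_iff.mpr (by positivity), ?_⟩
  intro c hc hcc u p hsol hdss hdec
  exact hW c hc hcc.le u p hsol hdss hdec

/-- **Chae–Wolf 1.3 + inhabitation of the two (monotone) predicates ⇒ the `flat_window` rung as typed**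
(shrink nothing, enlarge `B` until `exp(δ₀/(2B)) ≤ √c₁ < c₁`). [folklore] -/
theorem explicitWindowRung_of_chaeWolf (hcw : chaeWolf2017_removing_dss)
    (hδ : ∀ C₀ : ℝ, 0 < C₀ → ∃ δ₀ : ℝ, OneSliceThreshold C₀ δ₀)
    (hB : ∀ C₀ : ℝ, 0 < C₀ → ∃ B : ℝ, 0 < B ∧ AccelerationBound C₀ B) :
    ∀ C₀ : ℝ, 0 < C₀ → ∃ δ₀ B : ℝ, 0 < δ₀ ∧ 0 < B ∧ OneSliceThreshold C₀ δ₀ ∧ AccelerationBound C₀ B ∧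
      ∀ c : ℝ, 1 < c → c ≤ Real.exp (δ₀ / (2 * B)) →
        ∀ (u : ℝ → EuclideanSpace ℝ (Fin 3) → EuclideanSpace ℝ (Fin 3)) (p : ℝ → EuclideanSpace ℝ (Fin 3) → ℝ),
          IsClassicalNSSolutionOn (Iio 0) 1 0 u p → IsDiscretelySelfSimilar c u → HasTypeIDecay C₀ u →
          ∀ t < 0, ∀ x, u t x = 0 := by
  intro C₀ hC₀
  obtain ⟨c₁, hc₁, hW⟩ := hcw C₀ hC₀
  obtain ⟨δ₀, hT⟩ := hδ C₀ hC₀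
  obtain ⟨B₀, hB₀, hA⟩ := hB C₀ hC₀
  have hδ₀ : 0 < δ₀ := hT.1
  have hℓ : 0 < Real.log c₁ := Real.log_pos hc₁
  set B : ℝ := max B₀ (δ₀ / Real.log c₁) with hBdef
  have hBpos : 0 < B := lt_max_of_lt_left hB₀
  refine ⟨δ₀, B, hδ₀, hBpos, hT, accelerationBound_mono hA (le_max_left _ _), ?_⟩
  intro c hc hcc u p hsol hdss hdec
  have hexp : δ₀ / (2 * B) ≤ Real.log c₁ / 2 := window_exponent_le hδ₀ hB₀ hℓ
  have hlt : c < c₁ := by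
    have h1 : Real.exp (δ₀ / (2 * B)) < Real.exp (Real.log c₁) :=
      Real.exp_lt_exp.mpr (by linarith)
    rw [Real.exp_log (lt_trans zero_lt_one hc₁)] at h1
    exact lt_of_le_of_lt hcc h1
  exact hW c hc hlt u p hsol hdss hdec

/-- **The `flat_window` rung AS TYPED ⟺ Chae–Wolf 2017 Thm 1.3** (the inhabitation of `OneSliceThreshold`
and `AccelerationBound` being the landed theorems `oneSliceThreshold_exists`, `stub_accelerationBound`).
[folklore] -/
theorem explicitWindowRung_iff_chaeWolf :
    (∀ C₀ : ℝ, 0 < C₀ → ∃ δ₀ B : ℝ, 0 < δ₀ ∧ 0 < B ∧ OneSliceThreshold C₀ δ₀ ∧ AccelerationBound C₀ B ∧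
      ∀ c : ℝ, 1 < c → c ≤ Real.exp (δ₀ / (2 * B)) →
        ∀ (u : ℝ → EuclideanSpace ℝ (Fin 3) → EuclideanSpace ℝ (Fin 3)) (p : ℝ → EuclideanSpace ℝ (Fin 3) → ℝ),
          IsClassicalNSSolutionOn (Iio 0) 1 0 u p → IsDiscretelySelfSimilar c u → HasTypeIDecay C₀ u →
          ∀ t < 0, ∀ x, u t x = 0) ↔
    chaeWolf2017_removing_dss :=
  ⟨chaeWolf_of_explicitWindowRung,
    fun h => explicitWindowRung_of_chaeWolf h oneSliceThreshold_exists stub_accelerationBound⟩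

/-! ### 3. The typed display pins no ratio -/

/-- **Arbitrarily thin witnesses.**  For every `C₀ > 0` and every `ℓ > 0` the rung holds with witnesses
`δ₀, B` satisfying their defining predicates AND `exp(δ₀/(2B)) < exp ℓ`: the `∃`-display certifies no
exclusion ratio `λ₀(C₀) > 1`. [folklore] -/
theorem explicitWindowRung_thin :
    ∀ C₀ : ℝ, 0 < C₀ → ∀ ℓ : ℝ, 0 < ℓ → ∃ δ₀ B : ℝ, 0 < δ₀ ∧ 0 < B ∧
      OneSliceThreshold C₀ δ₀ ∧ AccelerationBound C₀ B ∧ Real.exp (δ₀ / (2 * B)) < Real.exp ℓ ∧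
      ∀ c : ℝ, 1 < c → c ≤ Real.exp (δ₀ / (2 * B)) →
        ∀ (u : ℝ → EuclideanSpace ℝ (Fin 3) → EuclideanSpace ℝ (Fin 3)) (p : ℝ → EuclideanSpace ℝ (Fin 3) → ℝ),
          IsClassicalNSSolutionOn (Iio 0) 1 0 u p → IsDiscretelySelfSimilar c u → HasTypeIDecay C₀ u →
          ∀ t < 0, ∀ x, u t x = 0 := by
  intro C₀ hC₀ ℓ hℓ
  obtain ⟨δ₀, B₀, hδ₀, hB₀, hT, hA, hW⟩ := removingDss_explicitWindow C₀ hC₀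
  set B : ℝ := max B₀ (δ₀ / ℓ) with hBdef
  have hBpos : 0 < B := lt_max_of_lt_left hB₀
  have hexp : δ₀ / (2 * B) ≤ ℓ / 2 := window_exponent_le hδ₀ hB₀ hℓ
  refine ⟨δ₀, B, hδ₀, hBpos, hT, accelerationBound_mono hA (le_max_left _ _),
    Real.exp_lt_exp.mpr (by linarith), ?_⟩
  intro c hc hcc u p hsol hdss hdec
  -- the thin window lies inside the tree's window: `δ₀/(2B) ≤ δ₀/(2B₀)`
  have hmono : δ₀ / (2 * B) ≤ δ₀ / (2 * B₀) :=
    div_le_div_of_nonneg_left hδ₀.le (by positivity) (by linarith [le_max_left B₀ (δ₀ / ℓ)])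
  exact hW c hc (hcc.trans (Real.exp_le_exp.mpr hmono)) u p hsol hdss hdec

end Summit.NavierStokesRegularity.NavierStokesRegularity.Theorems.TypeIQuantSubcubicExp.Negative
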